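/-
Copyright (c) 2026 the pub-hodgecm-mathlib formalisation cell (harness21).  Prover seat hodgecm-mathlib-LH5-p03 (g2): brick (N1′) «G′-SIDE NON-NEGATIVE TEST FUNCTIONS» for
half A line LH3 (dealer LH3-plan (g3) RULINGS #5; consumer (NONDEG-G′) of the organ J of `F0_P3c_StubN9Direct`); 2026-09-02.
-/
import Literature.NumberTheory.Rogawski1990.ArchimedeanTransfer            -- ★ `ArchSmooth` (the archimedean test class by restriction), `ArchSmooth.hasCompactSupport`
import Literature.NumberTheory.Rogawski1990.TestFunctionsNonempty          -- ★ `UnitaryGroup.exists_archBump` (a smooth compactly supported bump on `GL_N(L ⊗ ℝ)` with `φ 1 = 1`)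
import Literature.NumberTheory.Automorphic.ArchFlowParametricIntegral      -- ★ `IsArchSmooth.comp_mul_left` (smoothness in the archimedean variable survives left translation)
import HarnessLib

/-!
# Non-negative archimedean test functions with a prescribed non-zero value: on `GL_N(L ⊗ ℝ)` and on `G′_∞ = U(H)(L⁺ ⊗ ℝ)`

Topic `NumberTheory/Rogawski1990`; namespace `Literature.NumberTheory.Rogawski1990`.  THEOREMS ONLY (no definition, no instance, no notation, no named fact, no `sorry`);
kernel lane `--supports stmt-HodgeConjecture-24833`.  Cell `pub/hodgecm-mathlib` (D-0151), crux H413 = `stmt-HodgeConjecture-24833`; half A line LH3 (closer stub `stub_N9`,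
archimedean endoscopic transfer), HOME skeleton `F0_P3c_StubN9Direct` v3 (LH3-plan (g3)), organ J `stub_N9jumpAgreement`: its proof EXHIBITS, per covered wall, a test function
`a′ ∈ C_c^∞(G′_∞)` with NON-ZERO (indeed positive) orbital-integral value — the non-vanishing is load-bearing inside J (LH3-plan RULINGS #4) and is fed by the brick
(NONDEG-G′), which reads THIS file: a real-valued, non-negative `a′ ∈ C_c^∞(G′_∞)` with `a′ γ₀ ≠ 0` at a PRESCRIBED point `γ₀`.  (N1′) = the `G′`-side mirror of (N1) (H-side
product test functions, LH2-p04 (g3)); no product structure is needed on the `G′` side.  HONEST LABEL: HC_CM is proved only modulo the 7 printed citations (2 remaining named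
inputs: hLiu418 = stmt-HodgeConjecture-24832, h413 = stmt-HodgeConjecture-24833) until rung 0 closes; this file is count-neutral (a brick of the organ J road).

WHAT.  (1) On `GL_N(L ⊗_ℚ ℝ)`: for every `c` there is `φ : GL_N(L ⊗ ℝ) → ℂ` continuous, compactly supported, smooth along the exponential charts (★ `IsArchSmooth` for
★ `archGroupGL N L`), REAL-VALUED AND NON-NEGATIVE (`0 ≤ re`, `im = 0`), with `φ c = 1`.  (2) On `G′_∞ = U(H)(L⁺ ⊗ ℝ)` (any `N`, any `H`): for every `γ₀` there is `a′` in
the archimedean test class ★ `ArchSmooth L N H` (restriction along the closed subgroup `U(H)_∞ ≤ GL_N(L ⊗ ℝ)`), compactly supported, real non-negative, with `a′ γ₀ = 1`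
(so `a′ γ₀ ≠ 0`).
PROOF.  ★ `UnitaryGroup.exists_archBump` gives a smooth compactly supported `φ₀` with `φ₀ 1 = 1` but exports no sign; SQUARE it, `ψ := φ₀ · star φ₀ = |φ₀|²` (real ≥ 0,
`ψ 1 = 1`, support unchanged, smooth by Mathlib `ContDiff.mul`∕`ContDiff.star`), and TRANSLATE, `φ x := ψ (c⁻¹ x)` (★ `IsArchSmooth.comp_mul_left`; compact support through the
homeomorphism `x ↦ c⁻¹ x`); restrict along `U(H)_∞ ↪ GL_N(L ⊗ ℝ)` (★ `ArchSmooth.hasCompactSupport`).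

* `exists_isArchSmooth_nonneg_eq_one_at` — (1), the `GL_N(L ⊗ ℝ)` statement.
* `exists_archSmooth_nonneg_eq_one_at` — (2) with `a′ γ₀ = 1`.
* **`exists_archSmooth_nonneg_ne_zero_at`** — (2) with `a′ γ₀ ≠ 0`: the (N1′) HEAD in LH3-plan (g3)'s spelling (`GpInf L (Matrix.diagonal α)` is the reducible abbrev of the
  carrier at `N := 3`, `H := Matrix.diagonal α`).

## References
* [BorelJacquet1979] A. Borel, H. Jacquet, *Automorphic forms and automorphic representations*, Proc. Sympos. Pure Math. 33 (1979), part 1, §1.1, §4.1 (the space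
  `C_c^∞(G_∞)`, stability under translations).
* [Borel1972] A. Borel, *Représentations de groupes localement compacts*, LNM 276 (1972), 3.4 (smooth bumps ∕ Dirac sequences).
* [Rogawski1990] J. D. Rogawski, *Automorphic Representations of Unitary Groups in Three Variables*, Ann. of Math. Stud. 123 (1990), §14.2 p. 233 (`f′_∞ ∈ C_c^∞(G′_∞)`).
-/

set_option autoImplicit false

noncomputable section

namespace Literature.NumberTheory.Rogawski1990

open _root_.NumberField _root_.NumberField.mixedEmbedding _root_.Topology
open Literature.NumberTheory.Automorphic
open scoped MatrixGroups Classical ContDiff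

open scoped Matrix.Norms.Operator in
-- the Lie algebra `𝔤𝔩_N(L ⊗ ℝ)` carries its operator norm only under this scope (as in ★ `exists_archBump`)
/-- **A NON-NEGATIVE SMOOTH BUMP ON `GL_N(L ⊗ ℝ)` WITH VALUE `1` AT A PRESCRIBED POINT**: for every `c ∈ GL_N(L ⊗_ℚ ℝ)` there is `φ : GL_N(L ⊗ ℝ) → ℂ` continuous, compactly
supported, smooth along the exponential charts (★ `IsArchSmooth (archGroupGL N L).carrier.subtype`), real-valued and non-negative (`0 ≤ (φ x).re`, `(φ x).im = 0`), with
`φ c = 1`: the square `|φ₀|²` of the bump of ★ `UnitaryGroup.exists_archBump`, left-translated by `c` (★ `IsArchSmooth.comp_mul_left`).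
[cite: Borel1972, 3.4] [cite: BorelJacquet1979, §1.1, §4.1] -/
theorem exists_isArchSmooth_nonneg_eq_one_at (L : Type) [Field L] [NumberField L] (N : ℕ) (c : GL (Fin N) (mixedSpace L)) :
    ∃ φ : GL (Fin N) (mixedSpace L) → ℂ, Continuous φ ∧ HasCompactSupport φ ∧ IsArchSmooth (archGroupGL N L).carrier.subtype φ ∧
      (∀ x, 0 ≤ (φ x).re ∧ (φ x).im = 0) ∧ φ c = 1 := by
  obtain ⟨φ₀, hc, hs, hsm, h1⟩ := UnitaryGroup.exists_archBump L N
  -- ## 1. square: `ψ := φ₀ · star φ₀ = |φ₀|²` (real, non-negative, `ψ 1 = 1`)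
  set ψ : GL (Fin N) (mixedSpace L) → ℂ := fun x => φ₀ x * star (φ₀ x) with hψ
  have hψc : Continuous ψ := hc.mul hc.star
  have hψs : HasCompactSupport ψ := hs.mul_right
  have hψsm : IsArchSmooth (archGroupGL N L).carrier.subtype ψ := fun g => (hsm g).mul (Complex.conjCLE.contDiff.comp (hsm g))
  have hψre : ∀ x, 0 ≤ (ψ x).re ∧ (ψ x).im = 0 := fun x => by
    simp only [hψ, Complex.star_def, Complex.mul_conj, Complex.ofReal_re, Complex.ofReal_im]
    exact ⟨Complex.normSq_nonneg _, trivial⟩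
  have hψ1 : ψ 1 = 1 := by
    simp only [hψ, h1, star_one, mul_one]
  -- ## 2. translate: `φ x := ψ (c⁻¹ x)`
  refine ⟨fun x => ψ (c⁻¹ * x), hψc.comp (continuous_const.mul continuous_id), hψs.comp_homeomorph (Homeomorph.mulLeft c⁻¹),
    hψsm.comp_mul_left _ c⁻¹, fun x => hψre _, ?_⟩
  simp only [inv_mul_cancel, hψ1]

/-- **A NON-NEGATIVE ARCHIMEDEAN TEST FUNCTION ON `G′_∞ = U(H)(L⁺ ⊗ ℝ)` WITH VALUE `1` AT A PRESCRIBED POINT** (any `N`, any `H`): for every `γ₀ ∈ U(H)_∞` there is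
`a′ : U(H)_∞ → ℂ` in the test class ★ `ArchSmooth L N H` (restriction along the closed subgroup `U(H)_∞ ≤ GL_N(L ⊗ ℝ)` of a continuous, compactly supported, chart-smooth
`φ`), compactly supported (★ `ArchSmooth.hasCompactSupport`), real-valued non-negative, with `a′ γ₀ = 1`: restrict ★ `exists_isArchSmooth_nonneg_eq_one_at` at `c := ↑γ₀`.
[cite: BorelJacquet1979, §4.1] [cite: Rogawski1990, §14.2 p. 233] -/
theorem exists_archSmooth_nonneg_eq_one_at (L : Type) [Field L] [NumberField L] [IsCMField L] (N : ℕ) (H : Matrix (Fin N) (Fin N) L)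
    (γ₀ : ↥(UnitaryGroup.arch (↥(maximalRealSubfield L)) L (IsCMField.complexConj L) N H)) :
    ∃ a' : ↥(UnitaryGroup.arch (↥(maximalRealSubfield L)) L (IsCMField.complexConj L) N H) → ℂ,
      ArchSmooth L N H a' ∧ HasCompactSupport a' ∧ (∀ g, 0 ≤ (a' g).re ∧ (a' g).im = 0) ∧ a' γ₀ = 1 := by
  obtain ⟨φ, hc, hs, hsm, hre, h1⟩ := exists_isArchSmooth_nonneg_eq_one_at L N (γ₀ : GL (Fin N) (mixedSpace L))
  have ha : ArchSmooth L N H (fun k : ↥(UnitaryGroup.arch (↥(maximalRealSubfield L)) L (IsCMField.complexConj L) N H) => φ (k : GL (Fin N) (mixedSpace L))) :=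
    ⟨φ, hc, hs, hsm, fun _ => rfl⟩
  exact ⟨_, ha, ha.hasCompactSupport, fun g => hre _, h1⟩

/-- **(N1′) HEAD — A NON-NEGATIVE ARCHIMEDEAN TEST FUNCTION ON `G′_∞` NOT VANISHING AT A PRESCRIBED POINT** (LH3-plan (g3) RULINGS #5 text, generic `N`, `H`; instantiate
`N := 3`, `H := Matrix.diagonal α` for `GpInf L (Matrix.diagonal α)`): `∃ a′, ArchSmooth L N H a′ ∧ HasCompactSupport a′ ∧ (∀ g, 0 ≤ (a′ g).re ∧ (a′ g).im = 0) ∧ a′ γ₀ ≠ 0`.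
Feeds (NONDEG-G′) of the organ J (non-vanishing orbital-integral value of a non-negative test function). [cite: BorelJacquet1979, §4.1] [cite: Rogawski1990, §14.2 p. 233] -/
theorem exists_archSmooth_nonneg_ne_zero_at (L : Type) [Field L] [NumberField L] [IsCMField L] (N : ℕ) (H : Matrix (Fin N) (Fin N) L)
    (γ₀ : ↥(UnitaryGroup.arch (↥(maximalRealSubfield L)) L (IsCMField.complexConj L) N H)) :
    ∃ a' : ↥(UnitaryGroup.arch (↥(maximalRealSubfield L)) L (IsCMField.complexConj L) N H) → ℂ,
      ArchSmooth L N H a' ∧ HasCompactSupport a' ∧ (∀ g, 0 ≤ (a' g).re ∧ (a' g).im = 0) ∧ a' γ₀ ≠ 0 := by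
  obtain ⟨a', ha, hs, hre, h1⟩ := exists_archSmooth_nonneg_eq_one_at L N H γ₀
  exact ⟨a', ha, hs, hre, by rw [h1]; exact one_ne_zero⟩

end Literature.NumberTheory.Rogawski1990

end
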